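import Summits.HubbardSuperconductivity.HubbardLadder.NeelSignC12SK0
import Summits.HubbardSuperconductivity.HubbardLadder.NeelSignPatternC12SR1
import Summits.HubbardSuperconductivity.HubbardLadder.NeelSignPatternC12SR2
import Summits.HubbardSuperconductivity.HubbardLadder.NeelSignPatternC12SR3
import Literature.MathematicalPhysics.QuantumLattice.HeisenbergStarIntegerSpectrum
import Literature.MathematicalPhysics.QuantumLattice.HeisenbergMarshallSameSublattice
import Literature.MathematicalPhysics.QuantumLattice.HeisenbergTorusTripletBound
import Literature.Barriers.HubbardSuperconductivity.InfraredBoundNeelSpinHalf2D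
import HarnessLib

/-!
# The Néel sign pattern of the square-lattice Heisenberg antiferromagnet, uniformly in the side: an `L`-uniform CEILING on the knight's-move correlation, `c_L(1,2) ≤ -q < 0` (HubbardLadder R2, H₀ line; device D41)

HONEST FRAMING: ladder R1–R4 with certified numbers; no claim on H/H₀.

`heisRedCorr2_C12_ceiling (k) (hk : 7 ≤ k) : heisRedCorr2 (2 * k) 1 1 2 ≤ (-41/10000 : ℝ)` — for
EVERY torus `(ℤ/2kℤ)²`, `k ≥ 7`, in
the ground state(s) of the spin-½ Heisenberg antiferromagnet (`heisRedCorr2 L 1 a b = ω_L(S₀^z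
S_(a,b)^z)`
averaged over the ground space, tree definition).  Proof: linear-programming duality,
every row a tree
theorem — the Kennedy–Lieb–Shastry window-dictionary infrared cut
(`kls_heis_windowDict_cut_spinHalf`) for
the kernel `NeelSign.C12SK0` with its `L`-uniform constant `W̄` (`NeelSign<tag>.lean`,
`riemannSum_le`), the Gram-window
rows `gramC12S_*` (`NeelSignPatternC12SR*.lean`),
the integer-spectrum STAR rows `starC12S_*` (device D41: for a centre `x` and an arm set
`P`, `spec(2 S_x·S_P) ⊆ ½ℕ ∪ (-½ℕ-1)` by angular-momentum addition,
whence `(2G+a)(2G+b) ⪰ 0` for consecutive admissible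
`a, b` — `Literature…HeisenbergStarIntegerSpectrum`, `heis_starRow_nat_even/odd`),
the triplet bound `c ≤ 1/12`
(`heisRedCorr2_le_one_div_twelve`), the Marshall–Lieb–Mattis sign rows
`(-1)^(a+b) c(a,b) ≥ 0` (`heisRedCorr2_nonneg_of_even` / `_nonpos_of_odd`), `c(0,0) = 1/4`,
`|c| ≤ 1/4`, `-1/8 ≤ c(0,1) ≤ -1/12`
(`Literature.Barriers…neg_heisBondCorr_spinHalf_le`, `heisBondCorr_le`); the dual multipliers were read
off the LP optimum (`pub-hubbard-r2/rplp/d41/scripts/final5k.py`,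
kit jobs in `rplp/d41/README.md`) and the final inequality
is `linarith` over the instantiated rows (exact dual bound recomputed in rational arithmetic by
`rplp/d41/scripts/asm41.py`).  Companions: the strict signs at distances 2, √5,
3 with the constants `1/1250`, `7/5000`, `11/5000`
(D39, request #190 — this file SHARPENS the distance-√5 constant), `c_L(1,1) ≥ 119/5000` (D40,
request #194) and the
finite-torus windows of pub-hubbard R2.  No claim whatsoever about the Hubbard model or about `L →
∞` order.
[cite: KLS1988JSP, eqs. (4), (6)-(9); DLS1978, Thm 3.2, App. C; Anderson1951, eq. (4); LiebMattis1962, Thm. 2]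
-/

namespace Summit.HubbardSuperconductivity.HubbardLadder

open Finset Literature.MathematicalPhysics.QuantumLattice Literature.Probability.LatticeModels

/-- For `7 ≤ k` and `0 < b ≤ 6` the site `(a,
b)` of the `2k × 2k` torus is not the origin (hypothesis of the triplet
bound `heisRedCorr2_le_one_div_twelve` at symbolic side length). -/
private theorem torusSiteC12S_ne_of_snd (k a b : ℕ) (hk : 7 ≤ k) (hb : 0 < b) (hb' : b ≤ 6) :
    (0 : TorusSite 2 (2 * k)) ≠ ![((a : ℕ) : ZMod (2 * k)), ((b : ℕ) : ZMod (2 * k))] := by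
  intro h
  have h1 := congr_fun h 1
  simp only [Pi.zero_apply, Matrix.cons_val_one] at h1
  have hd := (ZMod.natCast_eq_zero_iff b (2 * k)).mp h1.symm
  have := Nat.le_of_dvd hb hd
  omega

/-- Swap normal form for the reduced correlations: `c(a,b) = c(b,a)` whenever `b < a` — a CONDITIONAL rewrite
rule (`simp (disch := decide)` discharges the numeral side condition) that brings every `heisRedCorr2 L n a b` to the canonical
order `a ≤ b`. Filer's replacement (LEAN FILING REQUEST #190/#194/#200) of the generator's file-local tactic macro,
which the gate does not admit (`lint.code-exec`); no statement of this file is changed. [folklore] -/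
private theorem heisRedCorr2_swap_of_lt (L : ℕ) [NeZero L] (n a b : ℕ) (_h : b < a) :
    heisRedCorr2 L n a b = heisRedCorr2 L n b a := heisRedCorr2_swap L n a b

set_option maxHeartbeats 2000000 in
/-- Row `S0` of the `C12S` certificate: the integer-spectrum STAR row (device D41;
`heis_starRow_nat_even`: centre `x = (1,1)`, `4` arms at offsets `(-1, 0) (0, -1) (0, 1) (1, 0)`,
`n = 2`, (a,b) = (2, 3)) — `spec(2 S_x·S_P) ⊆ ½ℕ ∪ (-½ℕ - 1)` (angular-momentum addition) gives
`(2G+a)(2G+b) ⪰ 0`, here expanded into the canonical correlations. [cite: Anderson1951, eq. (4)] -/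
theorem starC12S_0 (k : ℕ) (hk : 7 ≤ k) :
    haveI : NeZero (2 * k) := ⟨by omega⟩
    (-9 : ℝ) ≤
      (96 : ℝ) * heisRedCorr2 (2 * k) 1 0 1 + (12 : ℝ) * heisRedCorr2 (2 * k) 1 0 2 +
      (24 : ℝ) * heisRedCorr2 (2 * k) 1 1 1 := by
  haveI : NeZero (2 * k) := ⟨by omega⟩
  have hlt : ∀ p ∈ insert ((1 : ℕ), (1 : ℕ)) ({((0 : ℕ), (1 : ℕ)), ((1 : ℕ), (0 : ℕ)), ((1 : ℕ),
      (2 : ℕ)), ((2 : ℕ), (1 : ℕ))} : Finset (ℕ × ℕ)),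
      p.1 < 2 * k ∧ p.2 < 2 * k := by
    intro p hp
    have hb : p.1 < 3 ∧ p.2 < 3 := by
      revert hp p
      decide
    constructor <;> omega
  have h := heis_starRow_nat_even (2 * k) ({((0 : ℕ), (1 : ℕ)), ((1 : ℕ), (0 : ℕ)), ((1 : ℕ),
      (2 : ℕ)), ((2 : ℕ), (1 : ℕ))} : Finset (ℕ × ℕ))
    ((1 : ℕ), (1 : ℕ)) (by decide) hlt (by decide) 2
  rw [Finset.sum_congr rfl (fun p hp => Finset.sum_erase_eq_sub hp)] at h
  simp only [Finset.sum_sub_distrib] at h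
  norm_num at h
  try simp (disch := decide) only [heisRedCorr2_swap_of_lt] at h
  have h00 : heisRedCorr2 (2 * k) 1 0 0 = 1 / 4 := by rw [heisRedCorr2_zero_zero]; norm_num
  rw [h00] at h
  linarith [h]

set_option maxHeartbeats 2000000 in
/-- Row `K0` of the `C12S` certificate: the Kennedy–Lieb–Shastry window-dictionary cut
(`kls_heis_windowDict_cut_spinHalf`) for the kernel `NeelSign.C12SK0` (certified constant `W̄ =
224212062967/274877906944`) at `x₀ = 93/400`.
[cite: KLS1988JSP, eqs. (4), (6)-(9); DLS1978, App. C] -/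
theorem irC12S_0 (k : ℕ) (hk : 7 ≤ k) :
    haveI : NeZero (2 * k) := ⟨by omega⟩
    (805876947487/6390911336448 : ℝ) * heisRedCorr2 (2 * k) 1 0 1 - (-6636068838469/219902325555200
        : ℝ) ≤
      (131/512 : ℝ) * heisRedCorr2 (2 * k) 1 0 2 + (117/1024 : ℝ) * heisRedCorr2 (2 * k) 1 0 3 +
      (-121/512 : ℝ) * heisRedCorr2 (2 * k) 1 0 4 + (27/256 : ℝ) * heisRedCorr2 (2 * k) 1 0 5 +
      (19/128 : ℝ) * heisRedCorr2 (2 * k) 1 1 1 + (-1 : ℝ) * heisRedCorr2 (2 * k) 1 1 2 +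
      (189/1024 : ℝ) * heisRedCorr2 (2 * k) 1 1 3 + (83/512 : ℝ) * heisRedCorr2 (2 * k) 1 1 4 +
      (41/128 : ℝ) * heisRedCorr2 (2 * k) 1 2 2 + (21/1024 : ℝ) * heisRedCorr2 (2 * k) 1 2 3 := by
  haveI : NeZero (2 * k) := ⟨by omega⟩
  have hK := kls_heis_windowDict_cut_spinHalf k (by omega) NeelSign.C12SK0.S NeelSign.C12SK0.w
    (b := (769/1024 : ℝ)) (t := (-1/2 : ℝ)) (Wbar := (224212062967/274877906944 : ℝ)) (x₀ :=
        (93/400 : ℝ)) (by norm_num)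
    NeelSign.C12SK0.KQ_nonneg (NeelSign.C12SK0.riemannSum_le k (by omega))
  rw [NeelSign.C12SK0.S, Finset.sum_insert (by decide), Finset.sum_insert (by decide),
      Finset.sum_insert (by decide), Finset.sum_insert (by decide), Finset.sum_insert (by decide),
      Finset.sum_insert (by decide), Finset.sum_insert (by decide), Finset.sum_insert (by decide),
      Finset.sum_insert (by decide), Finset.sum_insert (by decide), Finset.sum_insert (by decide),
      Finset.sum_insert (by decide), Finset.sum_insert (by decide), Finset.sum_insert (by decide),
      Finset.sum_insert (by decide), Finset.sum_insert (by decide), Finset.sum_insert (by decide),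
      Finset.sum_singleton] at hK
  simp only [NeelSign.C12SK0.w] at hK
  try simp (disch := decide) only [heisRedCorr2_swap_of_lt] at hK
  norm_num at hK ⊢
  linarith [hK]

set_option maxHeartbeats 4000000 in
/-- **DEVICE D41 (C12S)**: in the ground state of the spin-½ Heisenberg antiferromagnet on the
torus `(ℤ/2kℤ)²`, the
knight's-move correlation `c_L(1,2)` is NEGATIVE,
uniformly in the side — `heisRedCorr2 (2k) 1 1 2 ≤ (-41/10000 : ℝ)` for every
`k ≥ 7` (the Néel sign pattern `sign c(a,b) = (-1)^(a+b)` at this separation).  Proof = LP duality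
over 1 Kennedy–Lieb–Shastry
window-dictionary cut(s) (`irC12S_*`, kernel constants certified in `NeelSign.C12SK*`),
15 Gram-window rows (`gramC12S_*`),
1 integer-spectrum star rows (`starC12S_*`, device D41, `Literature…HeisenbergStarIntegerSpectrum`),
`c(0,0) = 1/4`, `|c(a,b)| ≤ 1/4`, Marshall sign rows `(-1)^(a+b) c(a,b) ≥ 0` (`heisRedCorr2_nonneg_of_even` / `_nonpos_of_odd`), `-1/8 ≤ c(0,1) ≤ -1/12` (infrared a-priori bound / Anderson bound); exact dual bound
`8219743911072999188535392387846807437 / 1997159792640000000000000000000000000000`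
(≈ 0.0041157), rounded down to `41/10000`.  HONEST FRAMING: ladder R1–R4 with certified numbers; no claim on H/H₀.
[cite: KLS1988JSP, eqs. (4), (6)-(9); DLS1978, Thm 3.2, App. C; Anderson1951, eq. (4)] -/
theorem heisRedCorr2_C12_ceiling (k : ℕ) (hk : 7 ≤ k) :
    haveI : NeZero (2 * k) := ⟨by omega⟩
    heisRedCorr2 (2 * k) 1 1 2 ≤ (-41/10000 : ℝ) := by
  haveI : NeZero (2 * k) := ⟨by omega⟩
  have h00 : heisRedCorr2 (2 * k) 1 0 0 = 1 / 4 := by rw [heisRedCorr2_zero_zero]; norm_num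
  have hε : heisRedCorr2 (2 * k) 1 0 1 ≤ -1 / 12 := by
    have h1 := heisBondCorr_le (d := 2) (by norm_num) 1 k (by omega)
    rw [heisBondCorr_two_eq, heisRedCorr2_swap (2 * k) 1 1 0] at h1
    norm_num at h1 ⊢
    linarith
  have hεlo : -1 / 8 ≤ heisRedCorr2 (2 * k) 1 0 1 := by
    have h1 := Literature.Barriers.HubbardSuperconductivity.neg_heisBondCorr_spinHalf_le (d := 2)
        (by norm_num) (2 * k) (by omega)
    rw [heisBondCorr_two_eq, heisRedCorr2_swap (2 * k) 1 1 0] at h1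
    norm_num at h1 ⊢
    linarith
  have hm_0_2 : 0 ≤ heisRedCorr2 (2 * k) 1 0 2 :=
    heisRedCorr2_nonneg_of_even (2 * k) ⟨k, rfl⟩ 1 0 2 (by norm_num)
  have hm_0_3 : heisRedCorr2 (2 * k) 1 0 3 ≤ 0 :=
    heisRedCorr2_nonpos_of_odd (2 * k) ⟨k, rfl⟩ 1 0 3 (by norm_num)
  have ht_0_4 : heisRedCorr2 (2 * k) 1 0 4 ≤ 1 / 12 :=
    heisRedCorr2_le_one_div_twelve (2 * k) 0 4 (torusSiteC12S_ne_of_snd k 0 4 (by omega) (by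
        norm_num) (by norm_num))
  have hl_0_5 : -(1 / 4) ≤ heisRedCorr2 (2 * k) 1 0 5 := by
    have := (abs_le.mp (heisRedCorr2_abs_le (2 * k) 1 0 5)).1
    norm_num at this ⊢
    exact this
  have hm_1_1 : 0 ≤ heisRedCorr2 (2 * k) 1 1 1 :=
    heisRedCorr2_nonneg_of_even (2 * k) ⟨k, rfl⟩ 1 1 1 (by norm_num)
  have hl_1_2 : -(1 / 4) ≤ heisRedCorr2 (2 * k) 1 1 2 := by
    have := (abs_le.mp (heisRedCorr2_abs_le (2 * k) 1 1 2)).1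
    norm_num at this ⊢
    exact this
  have ht_1_3 : heisRedCorr2 (2 * k) 1 1 3 ≤ 1 / 12 :=
    heisRedCorr2_le_one_div_twelve (2 * k) 1 3 (torusSiteC12S_ne_of_snd k 1 3 (by omega) (by
        norm_num) (by norm_num))
  have hm_1_4 : heisRedCorr2 (2 * k) 1 1 4 ≤ 0 :=
    heisRedCorr2_nonpos_of_odd (2 * k) ⟨k, rfl⟩ 1 1 4 (by norm_num)
  have hm_1_5 : 0 ≤ heisRedCorr2 (2 * k) 1 1 5 :=
    heisRedCorr2_nonneg_of_even (2 * k) ⟨k, rfl⟩ 1 1 5 (by norm_num)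
  have hm_2_2 : 0 ≤ heisRedCorr2 (2 * k) 1 2 2 :=
    heisRedCorr2_nonneg_of_even (2 * k) ⟨k, rfl⟩ 1 2 2 (by norm_num)
  have hm_2_3 : heisRedCorr2 (2 * k) 1 2 3 ≤ 0 :=
    heisRedCorr2_nonpos_of_odd (2 * k) ⟨k, rfl⟩ 1 2 3 (by norm_num)
  have hm_2_4 : 0 ≤ heisRedCorr2 (2 * k) 1 2 4 :=
    heisRedCorr2_nonneg_of_even (2 * k) ⟨k, rfl⟩ 1 2 4 (by norm_num)
  have hl_2_5 : -(1 / 4) ≤ heisRedCorr2 (2 * k) 1 2 5 := by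
    have := (abs_le.mp (heisRedCorr2_abs_le (2 * k) 1 2 5)).1
    norm_num at this ⊢
    exact this
  have ht_3_3 : heisRedCorr2 (2 * k) 1 3 3 ≤ 1 / 12 :=
    heisRedCorr2_le_one_div_twelve (2 * k) 3 3 (torusSiteC12S_ne_of_snd k 3 3 (by omega) (by
        norm_num) (by norm_num))
  have hm_3_4 : heisRedCorr2 (2 * k) 1 3 4 ≤ 0 :=
    heisRedCorr2_nonpos_of_odd (2 * k) ⟨k, rfl⟩ 1 3 4 (by norm_num)
  have hm_3_5 : 0 ≤ heisRedCorr2 (2 * k) 1 3 5 :=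
    heisRedCorr2_nonneg_of_even (2 * k) ⟨k, rfl⟩ 1 3 5 (by norm_num)
  have hm_4_4 : 0 ≤ heisRedCorr2 (2 * k) 1 4 4 :=
    heisRedCorr2_nonneg_of_even (2 * k) ⟨k, rfl⟩ 1 4 4 (by norm_num)
  have hl_4_5 : -(1 / 4) ≤ heisRedCorr2 (2 * k) 1 4 5 := by
    have := (abs_le.mp (heisRedCorr2_abs_le (2 * k) 1 4 5)).1
    norm_num at this ⊢
    exact this
  have irC12S_0' := irC12S_0 k hk
  have starC12S_0' := starC12S_0 k hk
  have g0 := gramC12S_0 k (by omega)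
  have g1 := gramC12S_1 k (by omega)
  have g2 := gramC12S_2 k (by omega)
  have g3 := gramC12S_3 k (by omega)
  have g4 := gramC12S_4 k (by omega)
  have g5 := gramC12S_5 k (by omega)
  have g6 := gramC12S_6 k (by omega)
  have g7 := gramC12S_7 k (by omega)
  have g8 := gramC12S_8 k (by omega)
  have g9 := gramC12S_9 k (by omega)
  have g10 := gramC12S_10 k (by omega)
  have g11 := gramC12S_11 k (by omega)
  have g12 := gramC12S_12 k (by omega)
  have g13 := gramC12S_13 k (by omega)
  have g14 := gramC12S_14 k (by omega)
  linarith

end Summit.HubbardSuperconductivity.HubbardLadder
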